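import Summits.Ventures.WeilGRH.TwistedTwoPrimeCert
import Summits.Ventures.WeilGRH.TwistedBonusMoments
import HarnessLib

/-!
# Moment-method certificates for TWISTED Weil weights, XIII: the odd TWO-PRIME certificate format `TwistCert23Odd`

Cell `rh-explicit`, WEIL TRACK — GRH ARM (namespace `Summit.Ventures.WeilGRH`).  The two-prime analogue of `TwistCertOdd`
(`TwistedMomentCertOdd.lean`, verbatim over `TwistCert23`).  `TwistCert23Odd` = a `TwistCert23`
(`TwistedTwoPrimeCert.lean`: polar-free moment certificate, shifted table, `ellLo`) + the coefficient list `pc` of a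
polynomial approximant `P` of `sech` and the order `nn` of the `cosh` Taylor polynomial used in the error bound
`epsSechQ pc nn a₀` (`TwistedBonusSech.lean`).  For an ODD character the parity bonus
`(1/2π)∫|ĝ|² π sech(πτ) = ∫ (g ⋆ g̃)(w) dw/(2cosh(w/2))` is `≥ Σ_{k,l} bonCoeff pc a₀ k l · Re(conj M_k M_l) − 2a₀ε‖g‖₂²`
(`TwistedBonusMoments.lean`); the matrix `bonCoeff` has the Hankel-sign shape of `WeilCert.pmQ`, so it is put INTO
the block machinery by a second shift of the claimed table:

  table_q = nuScale·ν_q + symShift_q + bonShift_q,   bonShift_q = −(−1)^{q/2} · q! · pc_q · (a₀/2)^q / (2·invTwoPiHi)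

(`TwistCert23Odd.checkNuAt`), whence `pmQ(table) = −invTwoPiHi20·Ĝ + Bon` up to the table tolerance
(`abs_pmQ_sub_pmQexactOdd_le`, `pmQexactOdd_cast`); the bonus-approximation error `2a₀ε` comes off the coefficient
of `‖g‖₂²`: `kappaExactOdd = cert.kappaExact − 2·a₀·ε`.  `checkAlgOdd` = the scalar tests of the underlying
`TwistCert23` ∧ (`pc.length ≤ N+1`, odd entries of `pc` vanish, `0 < nn`, `0 ≤ κ_odd`) ∧ table ∧ the two parity blocks.  Soundness is in `TwistedMomentCertOddSound.lean`.
Everything here is PROVED; no named facts.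
-/

noncomputable section

open Complex Finset MeasureTheory Set Filter
open scoped Real Topology ComplexConjugate BigOperators

namespace Summit.Ventures.WeilGRH

open Literature.NumberTheory.LFunctions Literature.Analysis.ValidatedNumerics.Numerics
open Literature.Analysis.SpecialFunctions

/-- A moment-method certificate for the form of an ODD character: a `TwistCert23` plus the bonus polynomial data
`pc` (coefficients of an approximant of `sech`) and the `cosh`-Taylor order `nn` of its error bound. [folklore] -/
structure TwistCert23Odd where
  /-- the polar-free certificate (parameters, cells, shifted table, blocks, `ellLo`) -/
  cert : TwistCert23
  /-- coefficients of the polynomial approximant `P` of `sech` on `[−a₀, a₀]` (odd entries must vanish) -/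
  pc : List ℚ
  /-- order of the `cosh` Taylor polynomial in the error bound `epsSechQ pc nn a₀` -/
  nn : ℕ

namespace TwistCert23Odd

variable (c : TwistCert23Odd)

/-- The bonus shift of the table at (even) index `q`: `−(−1)^{q/2} · q! · pc_q · (a₀/2)^q / (2·invTwoPiHi)`. [folklore] -/
def bonShiftQ (q : ℕ) : ℚ :=
  -((-1 : ℚ) ^ (q / 2) * (q.factorial : ℚ) * getV c.pc q * (c.cert.frame.a0 / 2) ^ q / (2 * invTwoPiHi))

/-- Entry `q` of the claimed table is `nuScale·ν_q + symShift_q + bonShift_q` up to `2^{-pnu}`. [folklore] -/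
def checkNuAt (q : ℕ) : Bool :=
  decide (|getV c.cert.nuData q - (nuScale * c.cert.nuQ q + c.cert.symShiftQ q + c.bonShiftQ q)| ≤
    1 / 2 ^ c.cert.pnu)

/-- The claimed table is correct at the even indices `q ≤ 2N`. [folklore] -/
def checkNu : Bool := allBelow (c.cert.frame.N + 1) fun j ↦ c.checkNuAt (2 * j)

/-- The certified `sech`-approximation error `ε = epsSechQ pc nn a₀`. [folklore] -/
def epsB : ℚ := epsSechQ c.pc c.nn c.cert.frame.a0

/-- `κ_exact` of the odd certificate: the even one minus the bonus-approximation price `2a₀ε`. [folklore] -/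
def kappaExactOdd : ℚ := c.cert.kappaExact - 2 * c.cert.frame.a0 * c.epsB

/-- `κ = rd(κ_exact)`. [folklore] -/
def kappaQOdd : ℚ := ratRd c.cert.frame.pg c.kappaExactOdd

/-- The odd entries of `pc` vanish (`P` is even), checked below index `pc.length`. [folklore] -/
def checkPcEven : Bool := allBelow c.pc.length fun i ↦ decide (i % 2 = 1 → getV c.pc i = 0)

/-- Scalar side conditions: those of `TwistCert23` (with `κ_odd`), plus `pc.length ≤ N + 1`, `P` even, `0 < nn`. [folklore] -/
def checkScalarsOdd : Bool :=
  decide (0 < c.cert.b) && decide (c.cert.b ≤ c.cert.frame.a0) && decide (c.cert.frame.a0 ≤ 1) &&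
    decide (0 < c.cert.frame.T) && decide (2 * c.cert.frame.a0 * c.cert.frame.T ≤ (c.cert.frame.N : ℚ) + 2) &&
    decide (2 * (c.cert.frame.a0 * c.cert.frame.T) ^ (c.cert.frame.N + 1) / (c.cert.frame.N + 1).factorial ≤ 1) &&
    decide (c.cert.frame.N + 1 = 2 * c.cert.frame.nb) && decide (0 ≤ c.kappaQOdd) &&
    decide (c.pc.length ≤ c.cert.frame.N + 1) && c.checkPcEven && decide (0 < c.nn)

/-- **The algebraic checker** of an odd certificate: scalars, table (with bonus shift), two parity blocks. [folklore] -/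
def checkAlgOdd : Bool :=
  c.cert.checkScalars && c.checkScalarsOdd && c.checkNu &&
    c.cert.frame.checkBlockK c.cert.nuTab c.kappaQOdd 0 && c.cert.frame.checkBlockK c.cert.nuTab c.kappaQOdd 1

end TwistCert23Odd

namespace TwistCert23Odd

variable {c : TwistCert23Odd}

/-- Unpacking `checkAlgOdd`. [folklore] -/
theorem checkAlgOdd_spec (h : c.checkAlgOdd = true) :
    c.cert.checkScalars = true ∧ c.checkScalarsOdd = true ∧ c.checkNu = true ∧
      c.cert.frame.checkBlockK c.cert.nuTab c.kappaQOdd 0 = true ∧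
      c.cert.frame.checkBlockK c.cert.nuTab c.kappaQOdd 1 = true := by
  unfold checkAlgOdd at h
  simp only [Bool.and_eq_true] at h
  exact ⟨h.1.1.1.1, h.1.1.1.2, h.1.1.2, h.1.2, h.2⟩

/-- Unpacking `checkScalarsOdd`. [folklore] -/
theorem scalarsOdd_spec (h : c.checkScalarsOdd = true) :
    (0 < c.cert.b ∧ c.cert.b ≤ c.cert.frame.a0 ∧ c.cert.frame.a0 ≤ 1 ∧ 0 < c.cert.frame.T ∧
      2 * c.cert.frame.a0 * c.cert.frame.T ≤ (c.cert.frame.N : ℚ) + 2 ∧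
      2 * (c.cert.frame.a0 * c.cert.frame.T) ^ (c.cert.frame.N + 1) / (c.cert.frame.N + 1).factorial ≤ 1 ∧
      c.cert.frame.N + 1 = 2 * c.cert.frame.nb ∧ 0 ≤ c.kappaQOdd) ∧
      c.pc.length ≤ c.cert.frame.N + 1 ∧ c.checkPcEven = true ∧ 0 < c.nn := by
  unfold checkScalarsOdd at h
  simp only [Bool.and_eq_true, decide_eq_true_eq] at h
  obtain ⟨⟨⟨⟨⟨⟨⟨⟨⟨⟨h1, h2⟩, h3⟩, h4⟩, h5⟩, h6⟩, h7⟩, h8⟩, h9⟩, h10⟩, h11⟩ := h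
  exact ⟨⟨h1, h2, h3, h4, h5, h6, h7, h8⟩, h9, h10, h11⟩

/-- The scalar conditions of the underlying `TwistCert23` except `κ ≥ 0` (used by Step C). [folklore] -/
theorem scalars_base (h : c.checkScalarsOdd = true) :
    0 < c.cert.b ∧ c.cert.b ≤ c.cert.frame.a0 ∧ c.cert.frame.a0 ≤ 1 ∧ 0 < c.cert.frame.T ∧
      2 * c.cert.frame.a0 * c.cert.frame.T ≤ (c.cert.frame.N : ℚ) + 2 ∧
      2 * (c.cert.frame.a0 * c.cert.frame.T) ^ (c.cert.frame.N + 1) / (c.cert.frame.N + 1).factorial ≤ 1 ∧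
      c.cert.frame.N + 1 = 2 * c.cert.frame.nb :=
  let h' := (scalarsOdd_spec h).1
  ⟨h'.1, h'.2.1, h'.2.2.1, h'.2.2.2.1, h'.2.2.2.2.1, h'.2.2.2.2.2.1, h'.2.2.2.2.2.2.1⟩

/-- Odd entries of `pc` vanish. [folklore] -/
theorem getV_pc_odd {i : ℕ} (hi : i % 2 = 1) (h : c.checkPcEven = true) : getV c.pc i = 0 := by
  by_cases hlt : i < c.pc.length
  · unfold checkPcEven at h
    have := of_allBelow h hlt
    rw [decide_eq_true_eq] at this
    exact this hi
  · exact getV_eq_zero_of_length_le (not_lt.1 hlt)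

/-- The table agrees with `nuScale·nuQ + symShift + bonShift` at even `q ≤ 2N` up to `2^{-pnu}`. [folklore] -/
theorem abs_getV_nuTab_sub_le (h : c.checkNu = true) {q : ℕ} (hq : q ≤ 2 * c.cert.frame.N) (he : q % 2 = 0) :
    |getV c.cert.nuTab q - (nuScale * c.cert.nuQ q + c.cert.symShiftQ q + c.bonShiftQ q)| ≤ 1 / 2 ^ c.cert.pnu := by
  unfold checkNu at h
  have := of_allBelow h (k := q / 2) (by omega)
  unfold checkNuAt at this
  rw [show 2 * (q / 2) = q by omega] at this
  simpa [TwistCert23.nuTab] using this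

/-! ## The exact matrix with the bonus -/

/-- The rational bonus matrix in `pmQ` shape: `(−1)^k (k+l)! pc_{k+l} (a₀/2)^{k+l} / (2·k!·l!)` on equal parities. [folklore] -/
def bonQ (c : TwistCert23Odd) (k l : ℕ) : ℚ :=
  if k % 2 = l % 2 then
    (-1 : ℚ) ^ k * ((k + l).factorial : ℚ) * getV c.pc (k + l) * (c.cert.frame.a0 / 2) ^ (k + l) /
      (2 * (k.factorial * l.factorial))
  else 0

/-- The exact matrix realised by the doubly shifted table: `−invTwoPiHi20·Ĝ + Bon`. [folklore] -/
def pmQexactOdd (c : TwistCert23Odd) (k l : ℕ) : ℚ := TwistCert23.pmQexact c.cert k l + bonQ c k l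

/-- The bonus shift realises `bonQ` through `WeilCert.pmQ`'s table term (all indices). [folklore] -/
theorem bon_eq_shift (k l : ℕ) (hkl : k % 2 = l % 2) :
    bonQ c k l = -(invTwoPiHi * ((-1 : ℚ) ^ k * (-1 : ℚ) ^ ((k + l) / 2) * c.bonShiftQ (k + l) /
        (k.factorial * l.factorial))) := by
  have hq : (invTwoPiHi : ℚ) ≠ 0 := by unfold invTwoPiHi piLo; norm_num
  have hsq : ((-1 : ℚ) ^ ((k + l) / 2)) * ((-1 : ℚ) ^ ((k + l) / 2)) = 1 := by
    rw [← pow_add, ← two_mul]; exact (Even.neg_one_pow ⟨(k + l) / 2, by ring⟩)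
  unfold bonQ bonShiftQ
  rw [if_pos hkl]
  have e : -(invTwoPiHi * ((-1 : ℚ) ^ k * (-1 : ℚ) ^ ((k + l) / 2) *
        -((-1 : ℚ) ^ ((k + l) / 2) * ((k + l).factorial : ℚ) * getV c.pc (k + l) * (c.cert.frame.a0 / 2) ^ (k + l) /
          (2 * invTwoPiHi)) / (k.factorial * l.factorial))) =
      ((-1 : ℚ) ^ k * ((k + l).factorial : ℚ) * getV c.pc (k + l) * (c.cert.frame.a0 / 2) ^ (k + l) /
        (2 * (k.factorial * l.factorial))) *
        (((-1 : ℚ) ^ ((k + l) / 2)) * ((-1 : ℚ) ^ ((k + l) / 2))) * (invTwoPiHi / invTwoPiHi) := by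
    field_simp
    try ring
  rw [e, hsq, div_self hq, mul_one, mul_one]

/-- Table tolerance: `|pmQ ν̃ k l − pmQexactOdd k l| ≤ invTwoPiHi · 2^{-pnu}` for `k, l ≤ N`. [folklore] -/
theorem abs_pmQ_sub_pmQexactOdd_le (hnu : c.checkNu = true) {k l : ℕ} (hk : k < c.cert.frame.N + 1)
    (hl : l < c.cert.frame.N + 1) :
    |c.cert.frame.pmQ c.cert.nuTab k l - pmQexactOdd c k l| ≤ invTwoPiHi * (1 / 2 ^ c.cert.pnu) := by
  have hq6 : (0 : ℚ) ≤ invTwoPiHi := by unfold invTwoPiHi piLo; norm_num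
  unfold WeilCert.pmQ pmQexactOdd TwistCert23.pmQexact
  by_cases hkl : k % 2 = l % 2
  · have htab := abs_getV_nuTab_sub_le hnu (q := k + l) (by omega) (by omega)
    rw [if_pos hkl, if_pos hkl, TwistCert23.sym_eq_shift (c := c.cert) k l, bon_eq_shift k l hkl]
    have hf : (0 : ℚ) < (k.factorial : ℚ) * (l.factorial : ℚ) := by positivity
    have hff : (1 : ℚ) ≤ (k.factorial : ℚ) * (l.factorial : ℚ) := by
      have h1 : (1 : ℚ) ≤ k.factorial := by exact_mod_cast Nat.one_le_iff_ne_zero.2 (Nat.factorial_ne_zero k)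
      have h2 : (1 : ℚ) ≤ l.factorial := by exact_mod_cast Nat.one_le_iff_ne_zero.2 (Nat.factorial_ne_zero l)
      nlinarith
    have e : invTwoPiHi * ((-1 : ℚ) ^ k * (-1 : ℚ) ^ ((k + l) / 2) * c.cert.symShiftQ (k + l) /
          (k.factorial * l.factorial)) -
        invTwoPiHi * ((-1 : ℚ) ^ k * (-1 : ℚ) ^ ((k + l) / 2) * getV c.cert.nuTab (k + l) /
          (k.factorial * l.factorial)) -
        (-(invTwoPiHi * ((-1 : ℚ) ^ k * (-1 : ℚ) ^ ((k + l) / 2) * (nuScale * c.cert.nuQ (k + l)) /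
            (k.factorial * l.factorial))) +
          -(invTwoPiHi * ((-1 : ℚ) ^ k * (-1 : ℚ) ^ ((k + l) / 2) * c.bonShiftQ (k + l) /
            (k.factorial * l.factorial)))) =
        -(invTwoPiHi * ((-1 : ℚ) ^ k * (-1 : ℚ) ^ ((k + l) / 2)) / (k.factorial * l.factorial)) *
          (getV c.cert.nuTab (k + l) -
            (nuScale * c.cert.nuQ (k + l) + c.cert.symShiftQ (k + l) + c.bonShiftQ (k + l))) := by
      field_simp
      ring
    rw [e, abs_mul, abs_neg]
    have hsgn : |invTwoPiHi * ((-1 : ℚ) ^ k * (-1 : ℚ) ^ ((k + l) / 2)) / (k.factorial * l.factorial)| ≤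
        invTwoPiHi := by
      rw [abs_div, abs_mul, abs_mul, abs_pow, abs_pow, abs_neg, abs_one, one_pow, one_pow, mul_one,
        abs_of_nonneg hq6, abs_of_pos hf, mul_one]
      exact div_le_self hq6 hff
    exact mul_le_mul hsgn htab (abs_nonneg _) hq6
  · unfold bonQ
    simp only [if_neg hkl, add_zero, sub_self, abs_zero]
    positivity

/-- Entry identity: `(pmQexactOdd k l : ℝ) = −q₂₀ Ĝ_{kl} + bonCoeff pc a₀ k l` (for `P` even). [folklore] -/
theorem pmQexactOdd_cast (hpc : c.checkPcEven = true) (k l : ℕ) :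
    ((pmQexactOdd c k l : ℚ) : ℝ) =
      -(((invTwoPiHi20 : ℚ) : ℝ) * TwistCert23.gHat c.cert k l) + bonCoeff c.pc (c.cert.frame.a0 : ℝ) k l := by
  unfold pmQexactOdd
  push_cast
  rw [TwistCert23.pmQexact_cast]
  congr 1
  unfold bonQ bonCoeff
  by_cases hkl : k % 2 = l % 2
  · rw [if_pos hkl]
    have hkf : (k.factorial : ℝ) ≠ 0 := by positivity
    have hlf : (l.factorial : ℝ) ≠ 0 := by positivity
    have hch : (((k + l).choose k : ℕ) : ℝ) = ((k + l).factorial : ℝ) / (k.factorial * l.factorial) := by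
      rw [eq_div_iff (mul_ne_zero hkf hlf), ← mul_assoc]
      have := Nat.choose_mul_factorial_mul_factorial (Nat.le_add_right k l)
      rw [Nat.add_sub_cancel_left] at this
      exact_mod_cast this
    have hsign : ((-1 : ℝ) ^ l) = (-1 : ℝ) ^ k := by
      rcases Nat.even_or_odd k with hke | hko
      · have hle : Even l := by
          rw [Nat.even_iff] at hke ⊢; omega
        rw [hke.neg_one_pow, hle.neg_one_pow]
      · have hlo : Odd l := by
          rw [Nat.odd_iff] at hko ⊢; omega
        rw [hko.neg_one_pow, hlo.neg_one_pow]
    set m := k + l with hm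
    rw [hch, hsign, div_pow, pow_succ]
    push_cast
    field_simp
    try ring
  · rw [if_neg hkl]
    have hodd : (k + l) % 2 = 1 := by omega
    rw [getV_pc_odd hodd hpc]
    push_cast
    ring

end TwistCert23Odd

end Summit.Ventures.WeilGRH

end
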